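import Mathlib.AlgebraicGeometry.AffineScheme
import Mathlib.RingTheory.DiscreteValuationRing.Basic
import Mathlib.RingTheory.Ideal.Quotient.Operations
import HarnessLib

/-!
# Global functions of `Spec(R/J) → Spec R`: surjectivity, kernel, and the DVR case

Bookkeeping for the thickenings `Spec(R/𝔪^{n+1}) → Spec R` of the closed point of the spectrum of a
discrete valuation ring, in the form consumed by the Čech comparison (which works with the rings
of global functions `Λ = Γ(Spec R, 𝒪)` and `Γ(Spec(R/J), 𝒪)` and the map
`(Spec mk_J)^* = appLE ⊤ ⊤` between them):

* `SpecQuot.appLE_top_top_eq` — `(Spec f)^*` on global functions is `f` conjugated by Mathlib's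
  `Scheme.ΓSpecIso`; hence for `f = mk_J : R → R/J` it is surjective
  (`appLE_mk_surjective`) with kernel `J` read in `Λ` (`mem_ker_appLE_mk_iff`);
* `SpecQuot.unifΓ` — for a DVR `R`, a uniformizer `ϖ` read in `Λ` (`Λ ≅ R` is a domain, `ϖ ≠ 0`),
  with `ker (Spec mk_{𝔪^{n+1}})^* = (ϖ^{n+1})` (`ker_appLE_mk_pow_maximalIdeal`) and
  `(Spec mk_𝔪)^* ϖ = 0` (`appLE_mk_maximalIdeal_unifΓ`);
* `SpecQuot.appLE_factor_comp` — transitivity `(Spec factor)^* ∘ (Spec mk_I)^* = (Spec mk_J)^*`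
  for `I ≤ J`.

Fully proved; no named facts.
-/

universe u

open CategoryTheory AlgebraicGeometry TopologicalSpace Opposite IsLocalRing

noncomputable section

namespace Literature.AlgebraicGeometry.Motives

namespace SpecQuot

variable {R S : CommRingCat.{u}}

/-- **`(Spec f)^*` on global functions is `f`, through `Γ(Spec R, 𝒪) ≅ R`.** [folklore] -/
theorem appLE_top_top_eq (f : R ⟶ S) (h : (⊤ : (Spec S).Opens) ≤ Spec.map f ⁻¹ᵁ ⊤) (x : Γ(Spec R, ⊤)) :
    (Spec.map f).appLE ⊤ ⊤ h x = (Scheme.ΓSpecIso S).inv (f ((Scheme.ΓSpecIso R).hom x)) := by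
  have h1 : (Spec.map f).appLE ⊤ ⊤ h = (Spec.map f).appTop := by
    rw [Scheme.Hom.appLE, Scheme.Hom.appTop,
      show (homOfLE h : (⊤ : (Spec S).Opens) ⟶ Spec.map f ⁻¹ᵁ ⊤) = 𝟙 _ from Subsingleton.elim _ _]
    erw [CategoryTheory.Functor.map_id]
    exact Category.comp_id _
  rw [h1]
  have h2 := congrArg (fun φ => φ.hom ((Scheme.ΓSpecIso R).hom x)) (Scheme.ΓSpecIso_inv_naturality f)
  simp only [CommRingCat.hom_comp, RingHom.coe_comp, Function.comp_apply] at h2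
  rw [h2]
  exact (congrArg _ (Iso.hom_inv_id_apply (Scheme.ΓSpecIso R) x)).symm

/-- **`(Spec mk_J)^*` is surjective on global functions.** [folklore] -/
theorem appLE_mk_surjective {A : Type u} [CommRing A] (J : Ideal A)
    (h : (⊤ : (Spec (.of (A ⧸ J))).Opens) ≤ Spec.map (CommRingCat.ofHom (Ideal.Quotient.mk J)) ⁻¹ᵁ ⊤) :
    Function.Surjective ((Spec.map (CommRingCat.ofHom (Ideal.Quotient.mk J))).appLE ⊤ ⊤ h) := by
  intro y
  obtain ⟨a, ha⟩ := Ideal.Quotient.mk_surjective ((Scheme.ΓSpecIso (.of (A ⧸ J))).hom y)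
  refine ⟨(Scheme.ΓSpecIso (.of A)).inv a, ?_⟩
  rw [appLE_top_top_eq, Iso.inv_hom_id_apply]
  change (Scheme.ΓSpecIso (.of (A ⧸ J))).inv (Ideal.Quotient.mk J a) = y
  rw [ha, Iso.hom_inv_id_apply]

/-- **The kernel of `(Spec mk_J)^*` on global functions is `J`** (read through `Γ(Spec A, 𝒪) ≅ A`).
[folklore] -/
theorem mem_ker_appLE_mk_iff {A : Type u} [CommRing A] (J : Ideal A)
    (h : (⊤ : (Spec (.of (A ⧸ J))).Opens) ≤ Spec.map (CommRingCat.ofHom (Ideal.Quotient.mk J)) ⁻¹ᵁ ⊤)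
    (x : Γ(Spec (.of A), ⊤)) :
    (Spec.map (CommRingCat.ofHom (Ideal.Quotient.mk J))).appLE ⊤ ⊤ h x = 0 ↔
      (Scheme.ΓSpecIso (.of A)).hom x ∈ J := by
  rw [appLE_top_top_eq, ← Ideal.Quotient.eq_zero_iff_mem]
  change (Scheme.ΓSpecIso (.of (A ⧸ J))).inv (Ideal.Quotient.mk J ((Scheme.ΓSpecIso (.of A)).hom x)) = 0 ↔ _
  exact map_eq_zero_iff _ (ConcreteCategory.bijective_of_isIso (Scheme.ΓSpecIso (.of (A ⧸ J))).inv).1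

/-- Transitivity of the quotient maps on global functions: for `I ≤ J`,
`(Spec factor)^* ((Spec mk_I)^* x) = (Spec mk_J)^* x`. [folklore] -/
theorem appTop_factor_appLE_mk {A : Type u} [CommRing A] {I J : Ideal A} (hIJ : I ≤ J)
    (hI : (⊤ : (Spec (.of (A ⧸ I))).Opens) ≤ Spec.map (CommRingCat.ofHom (Ideal.Quotient.mk I)) ⁻¹ᵁ ⊤)
    (hJ : (⊤ : (Spec (.of (A ⧸ J))).Opens) ≤ Spec.map (CommRingCat.ofHom (Ideal.Quotient.mk J)) ⁻¹ᵁ ⊤)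
    (x : Γ(Spec (.of A), ⊤)) :
    (Spec.map (CommRingCat.ofHom (Ideal.Quotient.factor hIJ))).appTop
        ((Spec.map (CommRingCat.ofHom (Ideal.Quotient.mk I))).appLE ⊤ ⊤ hI x) =
      (Spec.map (CommRingCat.ofHom (Ideal.Quotient.mk J))).appLE ⊤ ⊤ hJ x := by
  have hf : (⊤ : (Spec (.of (A ⧸ J))).Opens) ≤
      Spec.map (CommRingCat.ofHom (Ideal.Quotient.factor hIJ)) ⁻¹ᵁ ⊤ := le_top
  have e : (Spec.map (CommRingCat.ofHom (Ideal.Quotient.factor hIJ))).appTop =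
      (Spec.map (CommRingCat.ofHom (Ideal.Quotient.factor hIJ))).appLE ⊤ ⊤ hf := by
    rw [Scheme.Hom.appLE, Scheme.Hom.appTop,
      show (homOfLE hf : (⊤ : (Spec (.of (A ⧸ J))).Opens) ⟶ _) = 𝟙 _ from Subsingleton.elim _ _]
    erw [CategoryTheory.Functor.map_id]
    exact (Category.comp_id _).symm
  rw [e, appLE_top_top_eq, appLE_top_top_eq, appLE_top_top_eq, Iso.inv_hom_id_apply]
  change (Scheme.ΓSpecIso (.of (A ⧸ J))).inv (Ideal.Quotient.factor hIJ
    (Ideal.Quotient.mk I ((Scheme.ΓSpecIso (.of A)).hom x))) =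
    (Scheme.ΓSpecIso (.of (A ⧸ J))).inv (Ideal.Quotient.mk J ((Scheme.ΓSpecIso (.of A)).hom x))
  rw [Ideal.Quotient.factor_mk]

/-! ### The DVR case -/

section DVR

variable (R : CommRingCat.{u}) [IsDomain R] [IsDiscreteValuationRing R]

/-- A uniformizer of the DVR `R`. [folklore] -/
def unif : R := (IsDiscreteValuationRing.exists_irreducible R).choose

/-- `𝔪 = (ϖ)`. [folklore] -/
theorem maximalIdeal_eq_span_unif : maximalIdeal R = Ideal.span {unif R} :=
  (IsDiscreteValuationRing.irreducible_iff_uniformizer _).1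
    (IsDiscreteValuationRing.exists_irreducible R).choose_spec

/-- `𝔪^{n} = (ϖ^{n})`. [folklore] -/
theorem maximalIdeal_pow_eq_span (n : ℕ) : maximalIdeal R ^ n = Ideal.span {unif R ^ n} := by
  rw [maximalIdeal_eq_span_unif, Ideal.span_singleton_pow]

/-- **The uniformizer read in `Λ = Γ(Spec R, 𝒪)`.** [folklore] -/
def unifΓ : Γ(Spec R, ⊤) := (Scheme.ΓSpecIso R).inv (unif R)

/-- `Γ(Spec R, 𝒪) ≅ R` is a domain. [folklore] -/
instance isDomain_Γ_Spec : IsDomain Γ(Spec R, ⊤) :=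
  (Scheme.ΓSpecIso R).commRingCatIsoToRingEquiv.toMulEquiv.isDomain

/-- `Γ(Spec R, 𝒪) ≅ R` is Noetherian. [folklore] -/
instance isNoetherianRing_Γ_Spec : IsNoetherianRing Γ(Spec R, ⊤) :=
  isNoetherianRing_of_ringEquiv R (Scheme.ΓSpecIso R).commRingCatIsoToRingEquiv.symm

/-- `ϖ ≠ 0` in `Λ`. [folklore] -/
theorem unifΓ_ne_zero : unifΓ R ≠ 0 := by
  intro h
  have := congrArg (Scheme.ΓSpecIso R).hom h
  rw [unifΓ, ← CommRingCat.comp_apply, Iso.inv_hom_id, CommRingCat.id_apply, map_zero] at this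
  exact (IsDiscreteValuationRing.exists_irreducible R).choose_spec.ne_zero this

/-- `(ΓSpecIso R).hom ϖ_Λ = ϖ`. [folklore] -/
theorem ΓSpecIso_hom_unifΓ : (Scheme.ΓSpecIso R).hom (unifΓ R) = unif R := by
  rw [unifΓ, ← CommRingCat.comp_apply, Iso.inv_hom_id, CommRingCat.id_apply]

/-- **The kernel of `(Spec mk_{𝔪^{n+1}})^*` on `Λ` is `(ϖ_Λ^{n+1})`.** [folklore] -/
theorem ker_appLE_mk_pow_maximalIdeal (n : ℕ)
    (h : (⊤ : (Spec (.of (R ⧸ maximalIdeal R ^ (n + 1)))).Opens) ≤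
      Spec.map (CommRingCat.ofHom (Ideal.Quotient.mk (maximalIdeal R ^ (n + 1)))) ⁻¹ᵁ ⊤) :
    RingHom.ker ((Spec.map (CommRingCat.ofHom (Ideal.Quotient.mk (maximalIdeal R ^ (n + 1))))).appLE
        ⊤ ⊤ h).hom = Ideal.span {unifΓ R ^ (n + 1)} := by
  ext x
  rw [RingHom.mem_ker]
  change (Spec.map (CommRingCat.ofHom (Ideal.Quotient.mk (maximalIdeal (R : Type u) ^ (n + 1))))).appLE
    ⊤ ⊤ h x = 0 ↔ _
  rw [mem_ker_appLE_mk_iff (A := R) (maximalIdeal R ^ (n + 1)) h x, maximalIdeal_pow_eq_span,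
    Ideal.mem_span_singleton, Ideal.mem_span_singleton]
  constructor
  · rintro ⟨c, hc⟩
    refine ⟨(Scheme.ΓSpecIso R).inv c, ?_⟩
    apply (ConcreteCategory.bijective_of_isIso (Scheme.ΓSpecIso R).hom).1
    change (Scheme.ΓSpecIso R).hom x = (Scheme.ΓSpecIso R).hom (unifΓ R ^ (n + 1) * (Scheme.ΓSpecIso R).inv c)
    rw [map_mul, map_pow, ΓSpecIso_hom_unifΓ, Iso.inv_hom_id_apply]
    exact hc
  · rintro ⟨c, hc⟩
    refine ⟨(Scheme.ΓSpecIso R).hom c, ?_⟩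
    change (Scheme.ΓSpecIso R).hom x = _
    rw [hc, map_mul, map_pow, ΓSpecIso_hom_unifΓ]

/-- **`(Spec mk_𝔪)^* ϖ_Λ = 0`**: the uniformizer dies on the closed point. [folklore] -/
theorem appLE_mk_maximalIdeal_unifΓ
    (h : (⊤ : (Spec (.of (R ⧸ maximalIdeal R))).Opens) ≤
      Spec.map (CommRingCat.ofHom (Ideal.Quotient.mk (maximalIdeal R))) ⁻¹ᵁ ⊤) :
    (Spec.map (CommRingCat.ofHom (Ideal.Quotient.mk (maximalIdeal R)))).appLE ⊤ ⊤ h (unifΓ R) = 0 := by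
  rw [mem_ker_appLE_mk_iff (A := R) (maximalIdeal R) h]
  change (Scheme.ΓSpecIso R).hom (unifΓ R) ∈ maximalIdeal R
  rw [ΓSpecIso_hom_unifΓ, maximalIdeal_eq_span_unif]
  exact Ideal.mem_span_singleton_self _

end DVR

end SpecQuot

end Literature.AlgebraicGeometry.Motives

end
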